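import Summits.QuantumAdvantage.AdviceFreeQNC0.BondTwistOdd
import Summits.QuantumAdvantage.AdviceFreeQNC0.WindowBells
import HarnessLib

/-!
# Cell qa-qnc0 — RUNG R-lin(odd m): **`ringOddModuliFormsSharp3 : RingOddModuliFormsSharp3`**
(planner qa-qnc0-p1 g20, `exp20/Sketch20x.lean` §5 "odd-twist principle", statement VERBATIM in `BondTwistOddSite.lean`)

Bells = arbitrary per-cut tables of `K ≤ (log₂ N)^C` linear forms of the input bits modulo an ODD `m` win on
`≤ (2/3 + ε)·2^{N−1}` odd inputs.  Proof = the R-lin3 template (`RingLinFormsGlue.ringLinFormsSharp3_of`) with the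
any-modulus regularise–expand inequality `LinForms.card_le_junta_add_twist_zmod` (junta `≤ K·⌈log₂ m⌉·(w−1)`, error `m^K·B`),
MAIN term `ringJuntaBellsSharp3` (tree, `WindowBells.lean`), ERROR term `twistBoundXOdd` (`ρ = cos(π/(2m)) < 1`,
`w = c₁K + m₁` with `m·ρ^{c₁} ≤ 1`, `|A|ρ^{m₁} ≤ ε/4`).  `m = 3` is `ringLinFormsSharp3`.

WHAT THIS IS NOT: even moduli are resonant and excluded; crux 22907 untouched; separation NOT moved.
-/

noncomputable section

namespace Summit.QuantumAdvantage.AdviceFreeQNC0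

open Finset Literature.Computability.QuantumComplexity Literature.Computability.QuantumComplexity.RingHLF
open Literature.Computability.MetaComplexity

namespace BondTwist3

open Real

/-- **RUNG R-lin(odd m) — PROVED.** -/
theorem ringOddModuliFormsSharp3 : RingOddModuliFormsSharp3 := by
  classical
  intro m _ hodd ε hε C
  obtain ⟨A, hA⟩ := twistBoundXOdd
  have hAm := hA m hodd
  obtain ⟨m₀, hm₀⟩ := ringJuntaBellsSharp3 (ε / 2) (by linarith)
  set ρ : ℝ := Real.cos (π / (2 * m)) with hρ
  have hmpos : (0 : ℝ) < m := by exact_mod_cast NeZero.pos m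
  have hρ0 : 0 ≤ ρ := by
    rw [hρ]; refine Real.cos_nonneg_of_neg_pi_div_two_le_of_le ?_ ?_
    · have : 0 ≤ π / (2 * m) := by positivity
      linarith [Real.pi_pos]
    · have : (1 : ℝ) ≤ m := by exact_mod_cast NeZero.one_le
      exact div_le_div_of_nonneg_left Real.pi_pos.le (by norm_num) (by linarith)
  have hρ1 : ρ < 1 := by
    rw [hρ, ← Real.cos_zero]
    refine Real.cos_lt_cos_of_nonneg_of_le_pi_div_two le_rfl ?_ (by positivity)
    have : (1 : ℝ) ≤ m := by exact_mod_cast NeZero.one_le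
    exact div_le_div_of_nonneg_left Real.pi_pos.le (by norm_num) (by linarith)
  have hρle1 : ρ ≤ 1 := hρ1.le
  -- `c₁` with `m · ρ^{c₁} ≤ 1`
  obtain ⟨c₁, hc₁⟩ : ∃ c₁ : ℕ, (m : ℝ) * ρ ^ c₁ ≤ 1 := by
    obtain ⟨k, hk⟩ := exists_pow_lt_of_lt_one (show 0 < 1 / (m : ℝ) by positivity) hρ1
    refine ⟨k, ?_⟩
    rw [lt_div_iff₀ hmpos] at hk
    linarith
  -- `m₁` with `|A| · ρ^{m₁} ≤ ε/4`
  obtain ⟨m₁, hm₁⟩ : ∃ m₁ : ℕ, |A| * ρ ^ m₁ ≤ ε / 4 := by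
    obtain ⟨k, hk⟩ := exists_pow_lt_of_lt_one (show 0 < (ε / 4) / (|A| + 1) by positivity) hρ1
    refine ⟨k, ?_⟩
    have hA1 : 0 < |A| + 1 := by positivity
    have := (lt_div_iff₀ hA1).1 hk
    nlinarith [abs_nonneg A, pow_nonneg hρ0 k]
  -- room for the junta: `D = (c₁ + m₁)·⌈log₂ m⌉`
  set L := Nat.clog 2 m with hL
  set D := (c₁ + m₁) * L with hD
  obtain ⟨n₀, hn₀⟩ := const_mul_logPow_le (m₀ * (D + 1)) (2 * C)
  refine ⟨max n₀ 1, fun N hN K hK lam tab => ?_⟩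
  have hNn₀ : n₀ ≤ N := le_trans (le_max_left _ _) hN
  have hN1 : 1 ≤ N := le_trans (le_max_right _ _) hN
  set w := c₁ * K + m₁ with hw
  obtain ⟨J, hJcard, hgen⟩ := LinForms.card_le_junta_add_twist_zmod (p := m) lam w
  set P : (Fin K → ZMod m) → (Fin N → Bool) → Prop := fun v x =>
    OddZeros x ∧ RingHLF.Rel x (fun k => xor (tGuess x k) (tab k v)) with hP
  set Bv : ℝ := |A| * ρ ^ w * (2 : ℝ) ^ N with hBv
  have hBv0 : 0 ≤ Bv := by positivity
  -- junta room `m₀ · (|J| + 1) ≤ N`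
  have hJN : m₀ * (J.card + 1) ≤ N := by
    set X := (Nat.log 2 N) ^ (2 * C) with hX
    have hKsq : K * K ≤ X := (Nat.mul_le_mul hK hK).trans (by rw [hX, ← pow_add, two_mul])
    have hK1 : K ≤ K * K := by
      rcases Nat.eq_zero_or_pos K with h | h
      · rw [h]
      · exact Nat.le_mul_of_pos_left K h
    have hKX : K ≤ X := hK1.trans hKsq
    have h1 : J.card ≤ D * X := by
      have a1 : J.card ≤ K * L * w := hJcard.trans (Nat.mul_le_mul_left _ (Nat.sub_le _ _))
      have a2 : K * L * w = L * (c₁ * (K * K) + m₁ * K) := by rw [hw]; ring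
      have a3 : c₁ * (K * K) + m₁ * K ≤ c₁ * X + m₁ * X :=
        add_le_add (Nat.mul_le_mul_left _ hKsq) (Nat.mul_le_mul_left _ hKX)
      have a4 : L * (c₁ * X + m₁ * X) = D * X := by rw [hD]; ring
      calc J.card ≤ K * L * w := a1
        _ = L * (c₁ * (K * K) + m₁ * K) := a2
        _ ≤ L * (c₁ * X + m₁ * X) := Nat.mul_le_mul_left _ a3
        _ = D * X := a4
    have h3 := hn₀ N hNn₀
    rw [← hX] at h3
    calc m₀ * (J.card + 1) ≤ m₀ * (D * X + 1) := Nat.mul_le_mul_left _ (by omega)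
      _ = m₀ * D * X + m₀ := by ring
      _ ≤ m₀ * (D + 1) * X + m₀ * (D + 1) :=
          add_le_add (Nat.mul_le_mul_right _ (Nat.mul_le_mul_left _ (by omega))) (Nat.le_mul_of_pos_right _ (by omega))
      _ ≤ N := h3
  -- hypothesis (a): junta-selected bells
  have ha : ∀ t : Fin K → ZMod m, ((univ.filter fun x : Fin N → Bool =>
      P (fun j => (∑ i ∈ J, if x i then lam j i else 0) + t j) x).card : ℝ) ≤ (2 / 3 + ε / 2) * (2 : ℝ) ^ (N - 1) := by
    intro t
    set Bx : (Fin N → Bool) → Finset (Fin N) := fun x =>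
      univ.filter fun k => tab k (fun j => (∑ i ∈ J, if x i then lam j i else 0) + t j) = true with hBx
    have hmeas : ∀ x y : Fin N → Bool, (∀ i ∈ J, x i = y i) → Bx x = Bx y := by
      intro x y hxy
      have : (fun j => (∑ i ∈ J, if x i then lam j i else 0) + t j) =
          (fun j => (∑ i ∈ J, if y i then lam j i else 0) + t j) := by
        funext j
        rw [sum_congr rfl fun i hi => by rw [hxy i hi]]
      simp only [hBx, this]
    have h := hm₀ N J hJN Bx hmeas
    refine le_trans (le_of_eq ?_) h
    congr 2
    refine filter_congr fun x _ => ?_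
    have hfun : (fun k => xor (tGuess x k) (tab k (fun j => (∑ i ∈ J, if x i then lam j i else 0) + t j))) =
        (fun k => xor (tGuess x k) (decide (k ∈ Bx x))) := by
      funext k
      simp only [hBx, mem_filter, mem_univ, true_and, Bool.decide_eq_true]
    simp only [hP, hfun]
  -- hypothesis (b): the odd twist bound
  have hb : ∀ (v : Fin K → ZMod m) (β : Fin N → ZMod m), w ≤ (univ.filter fun i => β i ≠ 0).card →
      ‖∑ x : Fin N → Bool, (ZMod.stdAddChar (∑ i, if x i then β i else 0) : ℂ) * (if P v x then (1 : ℂ) else 0)‖ ≤ Bv := by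
    intro v β hβ
    set B0 : Finset (Fin N) := univ.filter fun k => tab k v = true with hB0
    have h := hAm N B0 β
    have hfun : ∀ x : Fin N → Bool, (fun k => xor (tGuess x k) (decide (k ∈ B0))) =
        (fun k => xor (tGuess x k) (tab k v)) := by
      intro x; funext k
      simp only [hB0, mem_filter, mem_univ, true_and, Bool.decide_eq_true]
    simp only [hfun] at h
    refine le_trans h ?_
    rw [hBv]
    calc A * ρ ^ (univ.filter fun i => β i ≠ 0).card * (2 : ℝ) ^ N
        ≤ |A| * ρ ^ (univ.filter fun i => β i ≠ 0).card * (2 : ℝ) ^ N := by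
          gcongr; exact le_abs_self A
      _ ≤ |A| * ρ ^ w * (2 : ℝ) ^ N := by
          gcongr _ * ?_ * _
          exact pow_le_pow_of_le_one hρ0 hρle1 hβ
  have hmain := hgen P ((2 / 3 + ε / 2) * (2 : ℝ) ^ (N - 1)) Bv hBv0 ha hb
  have hset : (univ.filter fun x : Fin N → Bool =>
      OddZeros x ∧ RingHLF.Rel x (fun k => xor (tGuess x k) (tab k (fun j => ∑ i : Fin N, if x i then lam j i else 0)))) =
      univ.filter fun x : Fin N → Bool => P (fun j => ∑ i, if x i then lam j i else 0) x :=
    filter_congr fun x _ => by simp only [hP]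
  rw [hset]
  refine le_trans hmain ?_
  -- the error term `m^K · Bv ≤ (ε/2)·2^{N-1}`
  have herr : (m : ℝ) ^ K * Bv ≤ (ε / 2) * (2 : ℝ) ^ (N - 1) := by
    have h8 : (m : ℝ) ^ K * (ρ ^ c₁) ^ K ≤ 1 := by
      rw [← mul_pow]
      exact pow_le_one₀ (by positivity) hc₁
    have key : (m : ℝ) ^ K * Bv = ((m : ℝ) ^ K * (ρ ^ c₁) ^ K) * (|A| * ρ ^ m₁) * (2 : ℝ) ^ N := by
      rw [hBv, hw, pow_add, pow_mul]; ring
    have hN2 : (2 : ℝ) ^ N = 2 * (2 : ℝ) ^ (N - 1) := by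
      rw [← pow_succ']; congr 1; omega
    rw [key, hN2]
    have hp : (0 : ℝ) ≤ 2 * (2 : ℝ) ^ (N - 1) := by positivity
    have hq : 0 ≤ |A| * ρ ^ m₁ := by positivity
    calc ((m : ℝ) ^ K * (ρ ^ c₁) ^ K) * (|A| * ρ ^ m₁) * (2 * (2 : ℝ) ^ (N - 1))
        ≤ (1 * (ε / 4)) * (2 * (2 : ℝ) ^ (N - 1)) :=
          mul_le_mul_of_nonneg_right (mul_le_mul h8 hm₁ hq zero_le_one) hp
      _ = (ε / 2) * 2 ^ (N - 1) := by ring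
  linarith

end BondTwist3

end Summit.QuantumAdvantage.AdviceFreeQNC0

end
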